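import Summits.ABC.IUTFork.Conditional.HexDepthLocalType
import Literature.IUT.LogVolume.DepthConstantsTameBudget
import HarnessLib

/-!
# Branch C / R-W «GENUINE-NEG», SHARP BUDGET and the `E = 30·l` WINDOWS: the HEX engine of `HexDepthLocalType` with
# `d + a + b ≤ n + 6/5 − 6/(5e)` (abc-iut-S-d1's `depthConstants_le_of_not_dvd`) and an `E`-explicit strict criterion — the form
# that decides the boundary row `(k, l) = (12, 11)` once `e(K_{x₀}/ℚ_7) ≤ 330` — plus the integer windows of the `e ∣ 30·l` local type

PROOF-ONLY file (0 definitions, 0 `Prop` facts, no instance, no notation) of the abc-iut cell (seat abc-iut-W-neg-2, gen 0; D-0079 rescue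
sub-cell R-W; plan g9 MINT-LIST 18:12:16Z «W-neg-2 ← RESIDUAL GAP rows (12,11)/(11,13)/(11,37…61) after hloc30» and 18:21:53Z
«W-neg-2's engine takes hloc30»). TAKES NO SIDE on [IUTchIII] Cor. 3.12 (S. Mochizuki, *Inter-universal Teichmüller theory III*, RIMS
manuscript, Cor. 3.12 p. 173–174, Step (xi-f) p. 184) or on any author.

WHY. `GenuineK.exists_deep_place_lamSeven_of_ramification_le` (this seat, p458737) bounds the [IUTchIV] Prop. 1.2 constants of a tame
`7`-adic field by `n + 6/5 − 1/e` (`a ≤ 1/5 + 1/e`) and takes its strictness from the `−1/e`; its integer criterion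
`l((l+1)(10n+12)+20) ≤ 5k(l−3)(l+1)` therefore does not see `E` beyond the window `E < 6·7ⁿ`. At `(k, l) = (12, 11)` that criterion
fails by `4` (`5764 ≰ 5760`): the real inequality is the EXACT boundary `26.1818… = 288/11` at `e = 660 = 60·l` and holds at every
`e ≤ 330 = 30·l` — but only with the sharper `a = ⌈e/5⌉/e ≤ 1/5 + 4/(5e)`, i.e. the budget `d + a + b ≤ n + 6/5 − 6/(5e)` of
`Literature.IUT.LogVolume.depthConstants_le_of_not_dvd` (abc-iut-S-d1, `DepthConstantsTameBudget`, p455792), and an `E`-explicit criterion.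

* §1 `GenuineK.exists_deep_place_lamSeven_of_ramification_le_sharp` / `GenuineK.not_pilotKummerCompatHull_lamSeven_of_ramification_le_sharp`
  — `l ≥ 11` prime, `k ≥ 1`, `E < 6·7ⁿ`, hypothesis `∀ x₀ | 7, e(K_{x₀}/ℚ_7) ≤ E`, and the STRICT criterion
  `E·l·((l+1)(10n+12)+20) < 5·E·k·(l−3)(l+1) + 12·l·(l+1)` (⟺ `(j+1)(n + 6/5 − 6/(5E)) + 1 < (k/l)(j²−1)`, `j = (l−1)/2`) ⟹ the top label
  over `7` is deep at the CHOSEN realising q-idele of every genuine Θ-volume datum over `(ratPoint λ_k, l)`, hence S_H fails per datum for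
  every choice of the free binders (abc-iut-C-cert-1 p438886). For `E ↦ ∞` it degenerates to p458737's criterion.
* §2 the integer windows at `E = 30·l` (`n = 3 ⇔ l ≤ 68`, `n = 4 ⇔ l ≤ 480`, `n = 5 ⇔ l ≤ 3361`) for this seat's p458737 criterion:
  `HexLocalType.exists_window_thirty` (every `k ≥ 13`, `11 ≤ l ≤ 3361`), `HexLocalType.exists_window_thirty_frontier` (`k = 12` at
  `13 ≤ l ≤ 480`; `k = 11` at `17 ≤ l ≤ 480` — closing the rows `(11, 37…61)`; `k = 10` at `23 ≤ l ≤ 67`; `k = 9` at `l ∈ {53, 59, 61, 67}`),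
  and the §1 criterion at `(12, 11)`, `E = 330`: `HexLocalType.sharp_criterion_twelve_eleven` (`1 902 120 < 1 902 384`).
  The row `(11, 13)` is NOT decided by any local-type bound `≥ 30·l`: the genuine Tate type `e(v|7) = 2·15` gives `e = 390 ≥ 294`, `b = 3`,
  `d + a + b = 4.2 − 2/390 > 4.088` — it is the numerics' «SOME» row (HOME/plan/rescue/R-W/README.md F3-1), not a kernel target of this engine.
The consumers (`∀ x₀ | 7, e ∣ 30·l` at `(ratPoint λ_k, l)`, abc-iut-W-neg-1's `Cor22.ramificationIdx_subThetaField_dvd_thirty` lineage)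
take these by one application; until that lands the §1/§2 statements are hypothesis-generic and unconditional respectively.

HONEST SCOPE: SHARP reading; per-label licence = a STRONGER-THAN-PRINT sufficient form of (xi-f); nothing about the printed GLOBAL inequality,
the number-level `Cor22.Cor312AtDatum`, or any author's intended hull; HEX rows are Szpiro-GOOD (they test the WINDOW binder `hSHw` of the
uncut records only); no side taken on any author; typed ≠ proved; refuted-as-typed ≠ refuted-in-print; no abc claim.
[cite: Mochizuki2012, IUTchIII Cor. 3.12 Step (xi-f) p. 184; IUTchIV Prop. 1.2 p. 10, Cor. 2.2 (ii) proof (P5) p. 46]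
[cite: SerreLocalFields1979, Ch. III §6 Prop. 13] [claim: Mochizuki2012, status: disputed] for every IUT quotation.
-/

noncomputable section

open Set Function NumberField IsDedekindDomain

namespace Summit.ABC.IUTFork.Conditional

open Thm311 Thm311.Real Cor312 Cor312Vol Cor312Prov Literature.IUT.LogThetaLattice Literature.IUT.LogVolume
  Literature.IUT.HodgeTheaters Literature.IUT.LogVolume.ThetaData
  Literature.NumberTheory.NumberFields Literature.NumberTheory.DiophantineGeometry.GenEll
  Literature.NumberTheory.DiophantineGeometry Summit.ABC.ABC.Theorems

/-! ## §1. The sharp-budget engine (`a ≤ 1/5 + 4/(5e)`, `E`-explicit strict criterion) -/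

/-- **HEX depth under a local ramification bound — SHARP BUDGET.** Let `l ≥ 11` be prime, `k ≥ 1`, `E < 6·7ⁿ`, and
`E·l·((l+1)(10n+12) + 20) < 5·E·k·(l−3)(l+1) + 12·l·(l+1)` (⟺ `(j+1)(n + 6/5 − 6/(5E)) + 1 < (k/l)(j²−1)`, `j = (l−1)/2`). Then at
EVERY genuine Θ-volume datum `T` over `(ratPoint λ_k, l)` whose places `x₀ | 7` have `e(K_{x₀}/ℚ_7) ≤ E`, the top label `i = j − 1`
and some bad place `x₀ | 7` satisfy `7^{((i+2)(d+a+b)+1)}·‖t_q(x₀)‖^{(i+1)²−1} < 1` at the CHOSEN realising q-idele; the constants are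
bounded by `d + a + b ≤ 1 + 1/5 + n − 6/(5e) ≤ n + 6/5 − 6/(5E)` (`depthConstants_le_of_not_dvd`, tame case, `7e < 7ⁿ⁺¹·6`).
[cite: Mochizuki2012, IUTchIII Cor. 3.12 Step (xi-f) p. 184; IUTchIV Prop. 1.2 p. 10, Cor. 2.2 (ii) proof (P5) p. 46]
[cite: SerreLocalFields1979, Ch. III §6 Prop. 13] [claim: Mochizuki2012, status: disputed] -/
theorem GenuineK.exists_deep_place_lamSeven_of_ramification_le_sharp {k l n E : ℕ} (hk : 1 ≤ k) (hl : l.Prime) (h11 : 11 ≤ l)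
    (hE : E < 6 * 7 ^ n)
    (hkl : E * (l * ((l + 1) * (10 * n + 12) + 20)) < 5 * E * k * ((l - 3) * (l + 1)) + 12 * (l * (l + 1)))
    (T : Cor22.ThetaVolumeDatumAt (ratPoint ((2 : ℚ)⁻¹ + 2 / 7 ^ k)) l)
    (hloc : letI := T.instFieldF; letI := T.instNumberFieldF; letI := T.instAlgebraF; letI := T.instFieldK
      letI := T.instNumberFieldK; letI := T.instAlgebraK; letI := T.instFieldFbar; letI := T.instAlgebraFbar
      letI := T.instAlgebraKFbar; letI := T.instIsElliptic
      haveI : Fact (Nat.Prime 7) := ⟨by norm_num⟩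
      ∀ x₀ : (thetaIndex (pilotDataOfK T.D T.K)).Fibre (.inr ⟨7, by norm_num⟩),
        absRamificationIdx 7 (kOf (pilotDataOfK T.D T.K) 7 x₀) ≤ E) :
    letI := T.instFieldF; letI := T.instNumberFieldF; letI := T.instAlgebraF; letI := T.instFieldK
    letI := T.instNumberFieldK; letI := T.instAlgebraK; letI := T.instFieldFbar; letI := T.instAlgebraFbar
    letI := T.instAlgebraKFbar; letI := T.instIsElliptic
    haveI : Fact (Nat.Prime 7) := ⟨by norm_num⟩
    ∃ (i : Fin (thetaIndex (pilotDataOfK T.D T.K)).lstar) (x₀ : (thetaIndex (pilotDataOfK T.D T.K)).Fibre (.inr ⟨7, by norm_num⟩)),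
      (i : ℕ) = (l - 1) / 2 - 1 ∧
      placeOf (pilotDataOfK T.D T.K) 7 x₀ ∈ (pilotDataOfK T.D T.K).S ∧
      (7 : ℝ) ^ ((((i : ℕ) : ℝ) + 2) * (differentOrd 7 (kOf (pilotDataOfK T.D T.K) 7 x₀)
          + logRadiusA 7 (absRamificationIdx 7 (kOf (pilotDataOfK T.D T.K) 7 x₀))
          + logRadiusB 7 (absRamificationIdx 7 (kOf (pilotDataOfK T.D T.K) 7 x₀))) + 1) *
        ‖(exists_realising_qIdeles_pilotDataOfK T.D).choose ⟨7, by norm_num⟩ x₀‖ ^ (((i : ℕ) + 1) ^ 2 - 1) < 1 := by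
  classical
  letI := T.instFieldF; letI := T.instNumberFieldF; letI := T.instAlgebraF; letI := T.instFieldK
  letI := T.instNumberFieldK; letI := T.instAlgebraK; letI := T.instFieldFbar; letI := T.instAlgebraFbar
  letI := T.instAlgebraKFbar; letI := T.instIsElliptic
  haveI : Fact (Nat.Prime 7) := ⟨by norm_num⟩
  obtain ⟨x₀, hS, htame, -, -, hnorm⟩ := GenuineK.exists_place_lamSeven hk hl h11 T
  -- the top label
  have hlstar : (thetaIndex (pilotDataOfK T.D T.K)).lstar = (l - 1) / 2 := rfl
  have hil : (l - 1) / 2 - 1 < (thetaIndex (pilotDataOfK T.D T.K)).lstar := by rw [hlstar]; omega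
  refine ⟨⟨(l - 1) / 2 - 1, hil⟩, x₀, rfl, hS, ?_⟩
  -- the LOCAL ramification bound (hypothesis) and the sharp constants
  have he : absRamificationIdx 7 (kOf (pilotDataOfK T.D T.K) 7 x₀) ≤ E := hloc x₀
  have hepos : 0 < absRamificationIdx 7 (kOf (pilotDataOfK T.D T.K) 7 x₀) := absRamificationIdx_pos _ _
  have he' : (0 : ℝ) < absRamificationIdx 7 (kOf (pilotDataOfK T.D T.K) 7 x₀) := by exact_mod_cast hepos
  have hEpos : 0 < E := lt_of_lt_of_le hepos he
  have hE' : (0 : ℝ) < E := by exact_mod_cast hEpos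
  have heE : (absRamificationIdx 7 (kOf (pilotDataOfK T.D T.K) 7 x₀) : ℝ) ≤ E := by exact_mod_cast he
  have hhi : 7 * absRamificationIdx 7 (kOf (pilotDataOfK T.D T.K) 7 x₀) < 7 ^ (n + 1) * (7 - 1) := by
    rw [pow_succ]
    have h7n : 0 < 7 ^ n := pow_pos (by norm_num) n
    nlinarith
  have hX0 := depthConstants_le_of_not_dvd 7 (kOf (pilotDataOfK T.D T.K) 7 x₀) (k := n) (by norm_num) htame hhi
  set B : ℝ := n + 6 / 5 - 6 / (5 * (E : ℝ)) with hBdef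
  have hX : differentOrd 7 (kOf (pilotDataOfK T.D T.K) 7 x₀)
      + logRadiusA 7 (absRamificationIdx 7 (kOf (pilotDataOfK T.D T.K) 7 x₀))
      + logRadiusB 7 (absRamificationIdx 7 (kOf (pilotDataOfK T.D T.K) 7 x₀)) ≤ B := by
    have hfrac : 6 / (5 * (E : ℝ)) ≤ ((7 : ℝ) - 1) / (((7 : ℝ) - 2) * absRamificationIdx 7 (kOf (pilotDataOfK T.D T.K) 7 x₀)) := by
      rw [div_le_div_iff₀ (by positivity) (mul_pos (by norm_num) he')]
      nlinarith
    rw [hBdef]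
    norm_num at hX0 hfrac ⊢
    linarith
  -- label arithmetic: `j = (l−1)/2`, `2(j+1) = l+1`, `4(j²−1) = (l−3)(l+1)`
  set j : ℕ := (l - 1) / 2 with hj
  have h2j : 2 * j = l - 1 := by
    have hodd : l % 2 = 1 := Nat.odd_iff.mp (hl.odd_of_ne_two (by omega))
    omega
  have hj5 : 5 ≤ j := by omega
  have hjR : (j : ℝ) = ((l : ℝ) - 1) / 2 := by
    have : ((2 * j : ℕ) : ℝ) = ((l - 1 : ℕ) : ℝ) := by exact_mod_cast h2j
    push_cast [Nat.cast_sub (show 1 ≤ l by omega)] at this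
    linarith
  have hcast1 : ((((l - 1) / 2 - 1 : ℕ) : ℝ) + 2) = (j : ℝ) + 1 := by
    rw [← hj, Nat.cast_sub (show 1 ≤ j by omega)]
    push_cast; ring
  have hidx : (l - 1) / 2 - 1 + 1 = j := by rw [← hj]; omega
  have hcast2 : (((j ^ 2 - 1 : ℕ)) : ℝ) = ((j : ℝ) - 1) * ((j : ℝ) + 1) := by
    have : 1 ≤ j ^ 2 := Nat.one_le_pow _ _ (by omega)
    push_cast [Nat.cast_sub this]
    ring
  -- the hypothesis `hkl` in real form (divided by `20`):
  -- `E·l·((j+1)(n + 6/5) + 1) − (6/5)(j+1)·l < E·k·(j−1)(j+1)`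
  have hl0 : (0 : ℝ) < l := by exact_mod_cast hl.pos
  have hklR : (E : ℝ) * (l : ℝ) * (((j : ℝ) + 1) * ((n : ℝ) + 6 / 5) + 1) - 6 / 5 * ((j : ℝ) + 1) * (l : ℝ) <
      (E : ℝ) * (k : ℝ) * (((j : ℝ) - 1) * ((j : ℝ) + 1)) := by
    have h3 : 3 ≤ l := by omega
    have hR : ((E * (l * ((l + 1) * (10 * n + 12) + 20)) : ℕ) : ℝ) <
        ((5 * E * k * ((l - 3) * (l + 1)) + 12 * (l * (l + 1)) : ℕ) : ℝ) := by
      exact_mod_cast hkl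
    push_cast [Nat.cast_sub h3] at hR
    rw [hjR]
    nlinarith
  -- the strict exponent inequality
  have hlt : (((((l - 1) / 2 - 1 : ℕ)) : ℝ) + 2) * B + 1 <
      (k : ℝ) / l * ((((((l - 1) / 2 - 1 : ℕ)) + 1) ^ 2 - 1 : ℕ) : ℝ) := by
    rw [hcast1, hidx, hcast2, hBdef, div_mul_eq_mul_div, lt_div_iff₀ hl0]
    have hident : (((j : ℝ) + 1) * ((n : ℝ) + 6 / 5 - 6 / (5 * (E : ℝ))) + 1) * l =
        ((E : ℝ) * (l : ℝ) * (((j : ℝ) + 1) * ((n : ℝ) + 6 / 5) + 1) - 6 / 5 * ((j : ℝ) + 1) * (l : ℝ)) / E := by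
      field_simp
      ring
    rw [hident, div_lt_iff₀ hE']
    nlinarith
  have h := rpow_mul_pow_lt_one_of_lt (p := (7 : ℝ)) (by norm_num) (i := (l - 1) / 2 - 1) hX hlt
  rw [hnorm]
  exact h

/-- **S_H FAILS at every datum over `(λ_k, l)` satisfying the local ramification bound — SHARP-BUDGET form.** Under the hypotheses of
`GenuineK.exists_deep_place_lamSeven_of_ramification_le_sharp`, at the genuine Θ-volume datum `T` over `(ratPoint λ_k, l)`, for EVERY
region field, columns, frames, lattice, Frobenioid signature, q-pilot data and Kummer datum `qK`, the hull-level clause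
`Cor312Vol.PilotKummerCompatHull` at the sharp genuine setting over `K` (CHOSEN realising ideles, PINNED reading) is FALSE —
abc-iut-C-cert-1's `GenuineK.not_pilotKummerCompatHull_chosen_of_explicit_depth` at the deep packet of §1. Sharp reading; refuted-as-typed only.
[cite: Mochizuki2012, IUTchIII Cor. 3.12 Step (xi-f) p. 184] [claim: Mochizuki2012, status: disputed] -/
theorem GenuineK.not_pilotKummerCompatHull_lamSeven_of_ramification_le_sharp {k l n E : ℕ} (hk : 1 ≤ k) (hl : l.Prime)
    (h11 : 11 ≤ l) (hE : E < 6 * 7 ^ n)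
    (hkl : E * (l * ((l + 1) * (10 * n + 12) + 20)) < 5 * E * k * ((l - 3) * (l + 1)) + 12 * (l * (l + 1)))
    (T : Cor22.ThetaVolumeDatumAt (ratPoint ((2 : ℚ)⁻¹ + 2 / 7 ^ k)) l)
    (hloc : letI := T.instFieldF; letI := T.instNumberFieldF; letI := T.instAlgebraF; letI := T.instFieldK
      letI := T.instNumberFieldK; letI := T.instAlgebraK; letI := T.instFieldFbar; letI := T.instAlgebraFbar
      letI := T.instAlgebraKFbar; letI := T.instIsElliptic
      haveI : Fact (Nat.Prime 7) := ⟨by norm_num⟩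
      ∀ x₀ : (thetaIndex (pilotDataOfK T.D T.K)).Fibre (.inr ⟨7, by norm_num⟩),
        absRamificationIdx 7 (kOf (pilotDataOfK T.D T.K) 7 x₀) ≤ E) :
    letI := T.instFieldF; letI := T.instNumberFieldF; letI := T.instAlgebraF; letI := T.instFieldK
    letI := T.instNumberFieldK; letI := T.instAlgebraK; letI := T.instFieldFbar; letI := T.instAlgebraFbar
    letI := T.instAlgebraKFbar; letI := T.instIsElliptic
    ∀ (M : Type) [Field M] [NumberField M]
      (archPk : ∀ (j : (thetaIndex (pilotDataOfK T.D T.K)).Label) (vQ : (thetaIndex (pilotDataOfK T.D T.K)).VQ),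
        Set ((logShellsDH (pilotDataOfK T.D T.K) (analyticLogv T.K)).Packet j vQ))
      (archSub : ∀ (j : (thetaIndex (pilotDataOfK T.D T.K)).Label) (v : (thetaIndex (pilotDataOfK T.D T.K)).V),
        Set ((logShellsDH (pilotDataOfK T.D T.K) (analyticLogv T.K)).Packet j ((thetaIndex (pilotDataOfK T.D T.K)).over v)))
      (Ψ : ℤ → ∀ v : (thetaIndex (pilotDataOfK T.D T.K)).V, v ∈ (thetaIndex (pilotDataOfK T.D T.K)).Vbad →
        Set ((logShellsDH (pilotDataOfK T.D T.K) (analyticLogv T.K)).StarPacket v))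
      (act : ℤ → ∀ v : (thetaIndex (pilotDataOfK T.D T.K)).V, v ∈ (thetaIndex (pilotDataOfK T.D T.K)).Vbad →
        (logShellsDH (pilotDataOfK T.D T.K) (analyticLogv T.K)).StarPacket v →
          Module.End ℚ ((logShellsDH (pilotDataOfK T.D T.K) (analyticLogv T.K)).StarPacket v))
      (Mmod : ℤ → ∀ j : (thetaIndex (pilotDataOfK T.D T.K)).LabelStar,
        Set ((logShellsDH (pilotDataOfK T.D T.K) (analyticLogv T.K)).GlobalPacket j.1))
      (region : ℤ → ∀ j : (thetaIndex (pilotDataOfK T.D T.K)).LabelStar, FinDivisor M →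
        ∀ vQ : (thetaIndex (pilotDataOfK T.D T.K)).VQ, Set ((logShellsDH (pilotDataOfK T.D T.K) (analyticLogv T.K)).Packet j.1 vQ))
      (frobAdm : ℤ → ℤ → ∀ (j : (thetaIndex (pilotDataOfK T.D T.K)).Label) (vQ : (thetaIndex (pilotDataOfK T.D T.K)).VQ),
        Set ((logShellsDH (pilotDataOfK T.D T.K) (analyticLogv T.K)).Packet j vQ) → Prop)
      (frobLogvol : ℤ → ℤ → ∀ (j : (thetaIndex (pilotDataOfK T.D T.K)).Label) (vQ : (thetaIndex (pilotDataOfK T.D T.K)).VQ),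
        Set ((logShellsDH (pilotDataOfK T.D T.K) (analyticLogv T.K)).Packet j vQ) → ℝ)
      (frobΨ : ℤ → ℤ → ∀ v : (thetaIndex (pilotDataOfK T.D T.K)).V, v ∈ (thetaIndex (pilotDataOfK T.D T.K)).Vbad →
        Set ((logShellsDH (pilotDataOfK T.D T.K) (analyticLogv T.K)).StarPacket v))
      (frobMmod : ℤ → ℤ → ∀ j : (thetaIndex (pilotDataOfK T.D T.K)).LabelStar,
        Set ((logShellsDH (pilotDataOfK T.D T.K) (analyticLogv T.K)).GlobalPacket j.1))
      (unitImage : ℤ → ℤ → ℕ → ∀ (j : (thetaIndex (pilotDataOfK T.D T.K)).Label) (vQ : (thetaIndex (pilotDataOfK T.D T.K)).VQ),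
        Set ((logShellsDH (pilotDataOfK T.D T.K) (analyticLogv T.K)).Packet j vQ))
      (ballImage : ℤ → ℤ → ∀ (j : (thetaIndex (pilotDataOfK T.D T.K)).Label) (vQ : (thetaIndex (pilotDataOfK T.D T.K)).VQ),
        Set ((logShellsDH (pilotDataOfK T.D T.K) (analyticLogv T.K)).Packet j vQ))
      (thetaDiv : ℤ → ℤ → LgpDivisor M (thetaIndex (pilotDataOfK T.D T.K)).lstar)
      (n : ℤ) {HT : Type} {LogLink : HT → HT → Type} {IsFull : ∀ {s t : HT}, LogLink s t → Prop}
      (lat : LGPGaussianLogThetaLattice LogLink IsFull)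
      {Frd : Type} {IsoF : Frd → Frd → Type} {Ob : Frd → Type} {realify : Frd → Frd} {Strip : Type}
      {IsoS : Strip → Strip → Type} {Mv : ∀ v : (thetaIndex (pilotDataOfK T.D T.K)).V, v ∈ (thetaIndex (pilotDataOfK T.D T.K)).Vbad → Type}
      [∀ v h, Monoid (Mv v h)]
      (sig : GlobalLGPFrobenioidSignature (thetaIndex (pilotDataOfK T.D T.K)).lstar (thetaIndex (pilotDataOfK T.D T.K)).V
        (· ∈ (thetaIndex (pilotDataOfK T.D T.K)).Vbad) Frd IsoF Ob realify Strip IsoS Mv)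
      (split : SplittingMonoids Mv) {ObΔ : Type}
      {N : ∀ v : (thetaIndex (pilotDataOfK T.D T.K)).V, v ∈ (thetaIndex (pilotDataOfK T.D T.K)).Vbad → Type}
      [∀ v h, Monoid (N v h)] (qData : QPilotData ObΔ N)
      (qK : ∀ v : (thetaIndex (pilotDataOfK T.D T.K)).V, v ∈ (thetaIndex (pilotDataOfK T.D T.K)).Vbad →
        Set ((logShellsDH (pilotDataOfK T.D T.K) (analyticLogv T.K)).StarPacket v)),
    ¬ Cor312Vol.PilotKummerCompatHull
        (LatticeSituation.ofShells (logShellsDH (pilotDataOfK T.D T.K) (analyticLogv T.K)) M archPk archSub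
          (summandPiecesPr (pilotDataOfK T.D T.K) (logvAnalytic_analyticLogv (F := T.K))).Adm
          (summandPiecesPr (pilotDataOfK T.D T.K) (logvAnalytic_analyticLogv (F := T.K))).logvol Ψ act Mmod region frobAdm
          frobLogvol frobΨ frobMmod unitImage ballImage thetaDiv)
        (settingPrVolSharp (pilotDataOfK T.D T.K) (logvAnalytic_analyticLogv (F := T.K)) M archPk archSub Ψ act Mmod region n
          lat sig split qData (exists_realising_qIdeles_pilotDataOfK T.D).choose (exists_realising_thetaIdeles_pilotDataOfK T.D).choose
          (exists_realising_qIdeles_pilotDataOfK T.D).choose_spec.1 (exists_realising_qIdeles_pilotDataOfK T.D).choose_spec.2.1)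
        (fun _ => Cor312.Setting.qRegion
          (settingPrVolSharp (pilotDataOfK T.D T.K) (logvAnalytic_analyticLogv (F := T.K)) M archPk archSub Ψ act Mmod region n
            lat sig split qData (exists_realising_qIdeles_pilotDataOfK T.D).choose (exists_realising_thetaIdeles_pilotDataOfK T.D).choose
            (exists_realising_qIdeles_pilotDataOfK T.D).choose_spec.1 (exists_realising_qIdeles_pilotDataOfK T.D).choose_spec.2.1))
        qK := by
  letI := T.instFieldF; letI := T.instNumberFieldF; letI := T.instAlgebraF; letI := T.instFieldK
  letI := T.instNumberFieldK; letI := T.instAlgebraK; letI := T.instFieldFbar; letI := T.instAlgebraFbar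
  letI := T.instAlgebraKFbar; letI := T.instIsElliptic
  intro M _ _ archPk archSub Ψ act Mmod region frobAdm frobLogvol frobΨ frobMmod
    unitImage ballImage thetaDiv n' HT LogLink IsFull lat Frd IsoF Ob realify Strip IsoS Mv _ sig split ObΔ N _ qData qK
  obtain ⟨i, x₀, -, -, hdeep⟩ := GenuineK.exists_deep_place_lamSeven_of_ramification_le_sharp hk hl h11 hE hkl T hloc
  exact GenuineK.not_pilotKummerCompatHull_chosen_of_explicit_depth T.D M archPk archSub Ψ act Mmod region frobAdm frobLogvol
    frobΨ frobMmod unitImage ballImage thetaDiv n' lat sig split qData qK ⟨7, by norm_num⟩ i x₀ hdeep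

/-! ## §2. The integer windows of the `e ∣ 30·l` local type -/

namespace HexLocalType

/-- **The p458737 criterion at `E = 30·l`, every `k ≥ 13`, every prime `11 ≤ l ≤ 3361`**: `n = 3` for `l ≤ 68` (`30·l ≤ 2040 < 2058`),
`n = 4` for `69 ≤ l ≤ 480` (`30·l ≤ 14400 < 14406`), `n = 5` for `481 ≤ l ≤ 3361` (`30·l ≤ 100830 < 100842`); at `k = 13` the three
polynomial conditions are `23l² ≥ 192l + 195`, `13l² ≥ 202l + 195`, `3l² ≥ 212l + 195`; larger `k` by monotonicity. [folklore] -/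
theorem exists_window_thirty {k l : ℕ} (hk : 13 ≤ k) (h11 : 11 ≤ l) (h3361 : l ≤ 3361) :
    ∃ n : ℕ, 30 * l < 6 * 7 ^ n ∧ l * ((l + 1) * (10 * n + 12) + 20) ≤ 5 * k * ((l - 3) * (l + 1)) := by
  have h3 : 3 ≤ l := by omega
  have hmono : ∀ n : ℕ, l * ((l + 1) * (10 * n + 12) + 20) ≤ 5 * 13 * ((l - 3) * (l + 1)) →
      l * ((l + 1) * (10 * n + 12) + 20) ≤ 5 * k * ((l - 3) * (l + 1)) := fun n h =>
    h.trans (Nat.mul_le_mul_right _ (Nat.mul_le_mul_left _ hk))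
  by_cases h68 : l ≤ 68
  · refine ⟨3, by omega, hmono 3 ?_⟩
    zify [h3]
    have h11' : (11 : ℤ) ≤ (l : ℤ) := by exact_mod_cast h11
    nlinarith [mul_nonneg (sub_nonneg.mpr h11') (by positivity : (0 : ℤ) ≤ 23 * (l : ℤ) + 61)]
  by_cases h480 : l ≤ 480
  · refine ⟨4, by omega, hmono 4 ?_⟩
    zify [h3]
    have h69 : (69 : ℤ) ≤ (l : ℤ) := by exact_mod_cast (show 69 ≤ l by omega)
    nlinarith [mul_nonneg (sub_nonneg.mpr h69) (by positivity : (0 : ℤ) ≤ 13 * (l : ℤ) + 695)]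
  · refine ⟨5, by omega, hmono 5 ?_⟩
    zify [h3]
    have h481 : (481 : ℤ) ≤ (l : ℤ) := by exact_mod_cast (show 481 ≤ l by omega)
    nlinarith [mul_nonneg (sub_nonneg.mpr h481) (by positivity : (0 : ℤ) ≤ 3 * (l : ℤ) + 1231)]

/-- **The p458737 criterion at `E = 30·l` BELOW `k = 13`** (the `e ∣ 30·l` frontier of that engine): `k = 12` at every prime
`13 ≤ l ≤ 480` (`n = 3`: `18l² ≥ 182l + 180` on `13…68`; `n = 4`: `8l² ≥ 192l + 180` on `69…480`), `k = 11` at every prime `17 ≤ l ≤ 480`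
(`n = 3`: `13l² ≥ 172l + 165` on `17…68` — the rows `(11, 37…61)` of the plan's residual gap; `n = 4`: `3l² ≥ 182l + 165` on `69…480`),
`k = 10` at every prime `23 ≤ l ≤ 67` (`8l² ≥ 162l + 150`), `k = 9` at `l ∈ {53, 59, 61, 67}` (`3l² ≥ 152l + 135`). [folklore] -/
theorem exists_window_thirty_frontier {k l : ℕ}
    (h : (k = 12 ∧ 13 ≤ l ∧ l ≤ 480) ∨ (k = 11 ∧ 17 ≤ l ∧ l ≤ 480) ∨ (k = 10 ∧ 23 ≤ l ∧ l ≤ 67) ∨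
      (k = 9 ∧ (l = 53 ∨ l = 59 ∨ l = 61 ∨ l = 67))) :
    ∃ n : ℕ, 30 * l < 6 * 7 ^ n ∧ l * ((l + 1) * (10 * n + 12) + 20) ≤ 5 * k * ((l - 3) * (l + 1)) := by
  rcases h with ⟨rfl, h13, h480⟩ | ⟨rfl, h17, h480⟩ | ⟨rfl, h23, h67⟩ | ⟨rfl, hl⟩
  · have h3 : 3 ≤ l := by omega
    by_cases h68 : l ≤ 68
    · refine ⟨3, by omega, ?_⟩
      zify [h3]
      have h13' : (13 : ℤ) ≤ (l : ℤ) := by exact_mod_cast h13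
      nlinarith [mul_nonneg (sub_nonneg.mpr h13') (by positivity : (0 : ℤ) ≤ 18 * (l : ℤ) + 52)]
    · refine ⟨4, by omega, ?_⟩
      zify [h3]
      have h69 : (69 : ℤ) ≤ (l : ℤ) := by exact_mod_cast (show 69 ≤ l by omega)
      nlinarith [mul_nonneg (sub_nonneg.mpr h69) (by positivity : (0 : ℤ) ≤ 8 * (l : ℤ) + 360)]
  · have h3 : 3 ≤ l := by omega
    by_cases h68 : l ≤ 68
    · refine ⟨3, by omega, ?_⟩
      zify [h3]
      have h17' : (17 : ℤ) ≤ (l : ℤ) := by exact_mod_cast h17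
      nlinarith [mul_nonneg (sub_nonneg.mpr h17') (by positivity : (0 : ℤ) ≤ 13 * (l : ℤ) + 49)]
    · refine ⟨4, by omega, ?_⟩
      zify [h3]
      have h69 : (69 : ℤ) ≤ (l : ℤ) := by exact_mod_cast (show 69 ≤ l by omega)
      nlinarith [mul_nonneg (sub_nonneg.mpr h69) (by positivity : (0 : ℤ) ≤ 3 * (l : ℤ) + 25)]
  · refine ⟨3, by omega, ?_⟩
    have h3 : 3 ≤ l := by omega
    zify [h3]
    have h23' : (23 : ℤ) ≤ (l : ℤ) := by exact_mod_cast h23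
    nlinarith [mul_nonneg (sub_nonneg.mpr h23') (by positivity : (0 : ℤ) ≤ 8 * (l : ℤ) + 22)]
  · rcases hl with rfl | rfl | rfl | rfl <;> exact ⟨3, by norm_num, by norm_num⟩

/-- **The §1 criterion at the boundary row `(k, l) = (12, 11)`, `E = 330 = 30·l`, `n = 3`**: `330·5764 = 1 902 120 < 1 902 384 =
5·330·12·96 + 12·132` (margin `264`; at `E = 660` it FAILS: `3 804 240 ≮ 3 803 184` — the row needs `∣ 30`, not `∣ 60`). [folklore] -/
theorem sharp_criterion_twelve_eleven :
    330 < 6 * 7 ^ 3 ∧ 330 * (11 * ((11 + 1) * (10 * 3 + 12) + 20)) < 5 * 330 * 12 * ((11 - 3) * (11 + 1)) + 12 * (11 * (11 + 1)) := by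
  constructor <;> norm_num

end HexLocalType

end Summit.ABC.IUTFork.Conditional

end
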